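import Mathlib
import Summits.PneNP.PneNP.Theorems.ClusUniversalCertificateCoordDefs

/-!
# Sketch (planner pnp-ideate-p1 g20) — the BLOCK HILBERT PROFILE for the crux `UniversalCertAll` (stmt-PneNP-19683)
FRONTIER rung F-N1; nothing here bears on P vs NP.  Objects for the crux idea `block-hilbert`: the unitriangular zeroing-order basis `gfun`,
the UP-weight `omegaW`, the level spaces `Flevel θ = span {gfun t | omegaW t ≥ θ}`, the profile `Psi`, the block-down dimension `bdown`,
and the three statements: Lemma Z (`PsiLeOmega`, provable), the conjecture (`BlockHilbertTwo`, all block sizes ≤ 2) and the known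
reduction UP ⇒ UCMix (`UPtoUCMix`, lit ROUND-5 §T.7a).
-/

set_option linter.dupNamespace false -- summit = sub-problem name (D-0017)

namespace Summit.PneNP.PneNP.Cruxes.UniversalCertAll.BlockHilbert

open Finset Summit.PneNP.PneNP.Theorems.ClusCoord

variable {M n : ℕ}

/-- block `j` is a zero block of the point `t`. -/
def IsZeroBlock (blk : Fin M → Fin n) (t : Fin M → ZMod 2) (j : Fin n) : Prop := ∀ i, blk i = j → t i = 0

open Classical in
/-- UP-weight `ω(t) = Σ_{j zero} (2^{b_j} − 1) + Σ_{j nonzero} (b_j − 1)`. -/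
noncomputable def omegaW (blk : Fin M → Fin n) (t : Fin M → ZMod 2) : ℕ :=
  ∑ j : Fin n, (if IsZeroBlock blk t j then 2 ^ bsize blk j - 1 else bsize blk j - 1)

open Classical in
/-- the unitriangular zeroing-order basis: `g_t(x) = [x agrees with t on every nonzero block of t]`. -/
noncomputable def gfun (blk : Fin M → Fin n) (t : Fin M → ZMod 2) : (Fin M → ZMod 2) → ZMod 2 :=
  fun x => if (∀ i, ¬ IsZeroBlock blk t (blk i) → x i = t i) then 1 else 0

/-- level space `F^θ = span {g_t : ω(t) ≥ θ}`. -/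
noncomputable def Flevel (blk : Fin M → Fin n) (θ : ℕ) : Submodule (ZMod 2) ((Fin M → ZMod 2) → ZMod 2) :=
  Submodule.span (ZMod 2) {f | ∃ t, θ ≤ omegaW blk t ∧ f = gfun blk t}

/-- functions supported on `Y`. -/
def FunOn (Y : Finset (Fin M → ZMod 2)) : Submodule (ZMod 2) ((Fin M → ZMod 2) → ZMod 2) where
  carrier := {f | ∀ x, x ∉ Y → f x = 0}
  add_mem' := by intro f g hf hg x hx; simp [hf x hx, hg x hx]
  zero_mem' := by intro x hx; simp
  smul_mem' := by intro c f hf x hx; simp [hf x hx]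

/-- the block Hilbert profile `Ψ(Y) = Σ_{θ=1}^{L} dim (F^θ ∩ Fun_Y)`, `L = Σ_j (2^{b_j} − 1)`. -/
noncomputable def Psi (blk : Fin M → Fin n) (Y : Finset (Fin M → ZMod 2)) : ℕ :=
  ∑ θ ∈ Finset.Icc 1 (∑ j : Fin n, (2 ^ bsize blk j - 1)), Module.finrank (ZMod 2) ↥(Flevel blk θ ⊓ FunOn Y)

/-- block-down dimension `bdim_Y(y)`: the largest `U ≤ ⊕_{j ∈ S(y)} V_j` with `y + U ⊆ Y`. -/
noncomputable def bdown (blk : Fin M → Fin n) (Y : Finset (Fin M → ZMod 2)) (y : Fin M → ZMod 2) : ℕ :=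
  sSup {d : ℕ | ∃ U : Submodule (ZMod 2) (Fin M → ZMod 2),
    (∀ u ∈ U, ∀ i, IsZeroBlock blk y (blk i) → u i = 0) ∧ (∀ u ∈ U, y + u ∈ Y) ∧ d = Module.finrank (ZMod 2) ↥U}

/-- the block cube of `s`: points agreeing blockwise with `0` or with `s` (a linear subspace, `⊕_{j ∈ S(s)} {0, s_j}`). -/
def cube (blk : Fin M → Fin n) (s : Fin M → ZMod 2) : Set (Fin M → ZMod 2) :=
  {x | ∀ j : Fin n, (∀ i, blk i = j → x i = 0) ∨ (∀ i, blk i = j → x i = s i)}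

open Classical in
/-- level of (the indicator of) a finite set `F`: `λ(1_F) = min {ω(s) : |F ∩ cube s| odd}`; by the cube transform
(`f ∈ F^θ ↔ Σ_{x ∈ cube s} f x = 0` whenever `ω(s) < θ`) one has `1_F ∈ F^θ ↔ θ ≤ λ(1_F)`. -/
noncomputable def lam (blk : Fin M → Fin n) (F : Finset (Fin M → ZMod 2)) : ℕ :=
  sInf {l : ℕ | ∃ s, l = omegaW blk s ∧ Odd (F.filter fun x => x ∈ cube blk s).card}

open Classical in
/-- upward capacity of `t` in `Y`: the best level of an UPWARD flat `t + W ⊆ Y`, `W ≤ ⊕_{j ∈ BZ(t)} V_j`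
(`W = 0` is allowed and gives the free levels `Σ_j (b_j − 1)`; `t` is the unique `≼`-minimal point of `t + W`). -/
noncomputable def lamUp (blk : Fin M → Fin n) (Y : Finset (Fin M → ZMod 2)) (t : Fin M → ZMod 2) : ℕ :=
  sSup {l : ℕ | ∃ W : Submodule (ZMod 2) (Fin M → ZMod 2),
    (∀ w ∈ W, ∀ i, ¬ IsZeroBlock blk t (blk i) → w i = 0) ∧ (∀ w ∈ W, t + w ∈ Y) ∧
    l = lam blk (Y.filter fun x => x - t ∈ W)}

/-- the upward profile `Υ(Y) = Σ_{t ∈ Y} λ_up(t)`. -/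
noncomputable def Upsilon (blk : Fin M → Fin n) (Y : Finset (Fin M → ZMod 2)) : ℕ := ∑ t ∈ Y, lamUp blk Y t

open Classical in
/-- number of nonzero blocks of `x` (the "norm"). -/
noncomputable def bnorm (blk : Fin M → Fin n) (x : Fin M → ZMod 2) : ℕ := #{j : Fin n | ¬ IsZeroBlock blk x j}

/-- `ℓ` is a linear order on the points (an injective labelling) refining the norm: zero-poorer points are larger. -/
def NormRefining (blk : Fin M → Fin n) (ℓ : (Fin M → ZMod 2) → ℕ) : Prop :=
  Function.Injective ℓ ∧ ∀ x x', bnorm blk x < bnorm blk x' → ℓ x < ℓ x'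

open Classical in
/-- TOP capacity of `t` in `Y` under the labelling `ℓ`: the best level `λ(1_G)` of a flat `G = t + U ⊆ Y` whose `ℓ`-largest point is `t`
(`U = 0` gives the free levels `Σ_j (b_j − 1)`). -/
noncomputable def lamTop (blk : Fin M → Fin n) (ℓ : (Fin M → ZMod 2) → ℕ) (Y : Finset (Fin M → ZMod 2)) (t : Fin M → ZMod 2) : ℕ :=
  sSup {l : ℕ | ∃ U : Submodule (ZMod 2) (Fin M → ZMod 2),
    (∀ u ∈ U, t + u ∈ Y) ∧ (∀ u ∈ U, u ≠ 0 → ℓ (t + u) < ℓ t) ∧ l = lam blk (Y.filter fun x => x - t ∈ U)}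

/-- the TOP profile `Σ_{t ∈ Y} λ^ℓ_Y(t)`. -/
noncomputable def UpsilonTop (blk : Fin M → Fin n) (ℓ : (Fin M → ZMod 2) → ℕ) (Y : Finset (Fin M → ZMod 2)) : ℕ :=
  ∑ t ∈ Y, lamTop blk ℓ Y t

/-- LEMMA Z (provable, size M): the profile never exceeds the UP right-hand side. -/
def PsiLeOmega : Prop := ∀ (M n : ℕ) (blk : Fin M → Fin n) (Y : Finset (Fin M → ZMod 2)),
  Psi blk Y ≤ ∑ t ∈ Y, omegaW blk t

/-- CONJECTURE (block Hilbert profile, all block sizes ≤ 2; verified exhaustively for M ≤ 4 and on the hard-core witnesses W130/W394):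
`Σ_{y ∈ Y} bdim_Y(y) ≤ Ψ(Y)`. -/
def BlockHilbertTwo : Prop := ∀ (M n : ℕ) (blk : Fin M → Fin n) (Y : Finset (Fin M → ZMod 2)),
  (∀ j, bsize blk j ≤ 2) → ∑ y ∈ Y, bdown blk Y y ≤ Psi blk Y

/-- KNOWN REDUCTION (lit ROUND-5 §T.7a, size M): UP for a block shape implies `UCMix` for it
(`dim_Y(y) ≤ Σ_{j ∈ BZ(y)} b_j + bdim_Y(y)` pointwise, by rank–nullity of the projection onto the zero blocks). -/
def UPtoUCMix : Prop := ∀ (M n : ℕ) (blk : Fin M → Fin n) (Y : Finset (Fin M → ZMod 2)),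
  (∑ y ∈ Y, bdown blk Y y ≤ ∑ t ∈ Y, omegaW blk t) → UCMix M n blk Y

/-- LEMMA O-UPWARD (provable, size M–L; the first piece of the Lemma-O₂ programme): indicators of upward flats with distinct base
points are linearly independent (a `≼`-minimal base point of a subfamily is covered exactly once), and `1_{t+W} ∈ F^θ` for `θ ≤ λ`;
hence levelwise `#{t ∈ Y : θ ≤ λ_up(t)} ≤ dim (F^θ ∩ Fun_Y)` and, summing, `Υ(Y) ≤ Ψ(Y)`.  (W130: 602 ≤ 620; W394: ≥ 2126 ≤ 2302.) -/
def UpsilonLePsi : Prop := ∀ (M n : ℕ) (blk : Fin M → Fin n) (Y : Finset (Fin M → ZMod 2)),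
  Upsilon blk Y ≤ Psi blk Y

/-- LEMMA O-TOP (provable, size M–L): for ANY injective labelling `ℓ`, flat indicators with pairwise distinct `ℓ`-largest points are
linearly independent (triangular), and `1_G ∈ F^θ ↔ θ ≤ λ(1_G)` (cube transform); hence `#{t : θ ≤ λ^ℓ_Y(t)} ≤ dim (F^θ ∩ Fun_Y)` levelwise
and `UpsilonTop ≤ Psi`. -/
def TopLePsi : Prop := ∀ (M n : ℕ) (blk : Fin M → Fin n) (ℓ : (Fin M → ZMod 2) → ℕ) (Y : Finset (Fin M → ZMod 2)),
  Function.Injective ℓ → UpsilonTop blk ℓ Y ≤ Psi blk Y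

/-- CONJECTURE TOP (planner g20; purely combinatorial — levels are cube-avoidance numbers `λ(1_{t+U}) = min {ω s : U ∩ cube s = 0}`):
for all block sizes ≤ 2 and EVERY norm-refining linear order, `Σ_y bdim_Y(y) ≤ Σ_t λ^ℓ_Y(t)`.  Verified with 0 violations on ALL subsets of
every shape with `M ≤ 4` (including `m = 1`, where it is pointwise and is exactly Lemma F + Lemma O of Theorem D) for several norm-refining
orders incl. random tie-breaks, and on random sets of (2,2,1), (2,2,2), (2,2,1,1); a non-refining order fails ((2,2): 5–9 of 65535). -/
def BlockTop : Prop := ∀ (M n : ℕ) (blk : Fin M → Fin n) (ℓ : (Fin M → ZMod 2) → ℕ) (Y : Finset (Fin M → ZMod 2)),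
  (∀ j, bsize blk j ≤ 2) → NormRefining blk ℓ → ∑ y ∈ Y, bdown blk Y y ≤ UpsilonTop blk ℓ Y

/-- existence of a norm-refining labelling (sort by (norm, anything)); size S. -/
def NormRefiningExists : Prop := ∀ (M n : ℕ) (blk : Fin M → Fin n), ∃ ℓ : (Fin M → ZMod 2) → ℕ, NormRefining blk ℓ

/-- `NormRefiningExists` holds: label by `(norm, enumeration index)`. -/
theorem normRefiningExists : NormRefiningExists := by
  intro M n blk
  classical
  let K : ℕ := Fintype.card (Fin M → ZMod 2)
  let e : (Fin M → ZMod 2) ≃ Fin K := Fintype.equivFin _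
  have mono : ∀ x x', bnorm blk x < bnorm blk x' → bnorm blk x * K + (e x : ℕ) < bnorm blk x' * K + (e x' : ℕ) := by
    intro x x' hlt
    have hx : (e x : ℕ) < K := (e x).isLt
    have : bnorm blk x + 1 ≤ bnorm blk x' := hlt
    calc bnorm blk x * K + (e x : ℕ) < bnorm blk x * K + K := by omega
      _ = (bnorm blk x + 1) * K := by ring
      _ ≤ bnorm blk x' * K := Nat.mul_le_mul_right _ this
      _ ≤ bnorm blk x' * K + (e x' : ℕ) := Nat.le_add_right _ _
  refine ⟨fun x => bnorm blk x * K + (e x : ℕ), ?_, mono⟩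
  intro x x' h
  dsimp only at h
  rcases Nat.lt_trichotomy (bnorm blk x) (bnorm blk x') with hlt | heq | hgt
  · exact absurd h (ne_of_lt (mono x x' hlt))
  · rw [heq] at h
    exact e.injective (Fin.ext (Nat.add_left_cancel h))
  · exact absurd h (ne_of_gt (mono x' x hgt))

/-- WEAKEST sufficient form of TOP (late g20): for every Y some INJECTIVE labelling ℓ (chosen per Y, not necessarily norm-refining)
already works — `TopLePsi` needs only injectivity.  Empirically pure lex orders (idx+) and every norm-refining order qualify. -/
def BlockTopExists : Prop := ∀ (M n : ℕ) (blk : Fin M → Fin n) (Y : Finset (Fin M → ZMod 2)),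
  (∀ j, bsize blk j ≤ 2) → ∃ ℓ : (Fin M → ZMod 2) → ℕ, Function.Injective ℓ ∧ ∑ y ∈ Y, bdown blk Y y ≤ UpsilonTop blk ℓ Y

theorem blockTopExists_of_top (hE : NormRefiningExists) (hT : BlockTop) : BlockTopExists := by
  intro M n blk Y h2
  obtain ⟨ℓ, hℓ⟩ := hE M n blk
  exact ⟨ℓ, hℓ.1, hT M n blk ℓ Y h2 hℓ⟩

theorem blockHilbertTwo_of_topExists (hO : TopLePsi) (hT : BlockTopExists) : BlockHilbertTwo := by
  intro M n blk Y h2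
  obtain ⟨ℓ, hinj, hle⟩ := hT M n blk Y h2
  exact hle.trans (hO M n blk ℓ Y hinj)

/-- TOP + Lemma O-top ⟹ the block Hilbert conjecture. -/
theorem blockHilbertTwo_of_top (hE : NormRefiningExists) (hO : TopLePsi) (hT : BlockTop) : BlockHilbertTwo := by
  intro M n blk Y h2
  obtain ⟨ℓ, hℓ⟩ := hE M n blk
  exact (hT M n blk ℓ Y h2 hℓ).trans (hO M n blk ℓ Y hℓ.1)

/-- the first checkable statement of the line: Lemma Z + the conjecture + the reduction give `UCMix` for every shape with blocks ≤ 2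
(in particular the crux's case m = 2). -/
theorem ucMix_of_blockHilbert (hZ : PsiLeOmega) (hB : BlockHilbertTwo) (hR : UPtoUCMix)
    (M n : ℕ) (blk : Fin M → Fin n) (Y : Finset (Fin M → ZMod 2)) (h2 : ∀ j, bsize blk j ≤ 2) : UCMix M n blk Y :=
  hR M n blk Y ((hB M n blk Y h2).trans (hZ M n blk Y))

end Summit.PneNP.PneNP.Cruxes.UniversalCertAll.BlockHilbert
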